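import Summits.CriticalPhenomena.Ising3DConformalLimit.Theses.PerfectScreening
import Literature.Probability.LatticeModels.GeneralisedFreeFamily
import Literature.Probability.LatticeModels.CriticalScalingDimension
import Literature.Probability.LatticeModels.CorrelationDecayProofs
import Literature.Probability.LatticeModels.PointwiseScalingLimitEtaExists
import Literature.Barriers.CriticalPhenomena.ScaleCovarianceNotMoebius

/-!
# Disproof of `GaussianLimitNotScreened` (stmt-CriticalPhenomena-13886) — findings

Crux (route PerfectScreening, r4): for every `(ρ, Δ, S)`, if `S` is a non-degenerate, Möbius-covariant
pointwise scaling limit of `criticalCorr 3` with `U₄ ≡ 0`, then the critical two-point function is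
NOT perfectly screened: `¬ (‖x‖ · criticalTwoPoint 3 x → 0` cofinitely`)`.

STATUS (cdisprove seat refuter-cdisprove-stmt-CriticalPhenomena-13886-0, 2026-08-16): NO KILL IS
POSSIBLE IN PRINCIPLE, and none of the MECHANISM-level attacks bites the statement; everything below
is `sorry`-free with axioms `propext / Classical.choice / Quot.sound`.

## Index

* §0 `crux_iff`, `not_crux_iff` (section (b)): the conclusion ignores `(ρ, Δ, S)`, so
  `Crux ↔ (GaussianMoebiusLimitExists → ¬ Screened)` and `¬ Crux ↔ GaussianMoebiusLimitExists ∧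
  Screened`: an unconditional refutation needs BOTH a free conformal limit of Ising₃ (believed false)
  AND `η > 0`-type screening (open). The crux is expected to hold only VACUOUSLY (`η ≈ 0.036`).
  Also: `crux_of_gaussianLimitIsCoulomb` (support 1343 ⇒ r4), `conjunct_of_crux_screened`
  (r4 ∧ Screened ∧ MoebiusLimitExists ⇒ the conjunct: on the screened branch r4 IS clause (iii)).
* §1 THE WITNESS `screenedLattice` (Wick family on `ℤ³` of `g(a,b) = ‖a-b‖₂⁻¹(1 + log ‖a-b‖₂)⁻¹`),
  `renorm δ = √((1 - log δ)/δ)`: `screenedLattice_hasLimit` (pointwise scaling limit = the massless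
  free field `gffFamily (1/2)`: Möbius, non-degenerate, `U₄ ≡ 0`) and `screenedLattice_screened`
  (`‖x‖ g(0,x) ≤ (1 + log ‖x‖)⁻¹ → 0`).
* (a1) `cruxWithoutIsing_false`: the MODEL-BLIND crux (`criticalCorr 3 ↦` arbitrary `G`) is FALSE.
* (a3) `cruxWithoutIsing_false'` — ALL ORDERS: the hafnian (free-field moment) family `haf K`
  of a pair kernel (§ Hafnian: `haf_map`, `pow_mul_haf`, `haf_smul`, `haf_inversion`,
  `limitConnectedFour_haf`, `tendsto_haf`) makes the witness an honest Gaussian lattice moment family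
  at EVERY order (`screenedLatticeAll := haf gL`) converging to the massless free field with all its
  correlators (`freeField := haf ‖·-·‖⁻¹`, `freeField_isMoebiusCovariant`); so the repair 'require S
  to be the full free field' does not help either.
* (a2) `cruxWithoutIsingSharp_false`: still false for lattice families that are translation
  invariant, pair-symmetric, GAUSSIAN ON THE LATTICE (Wick identity at order 4), odd-free and inside
  the Ising two-point window `c‖x‖⁻² ≤ G₂(0,x) ≤ C‖x‖⁻¹` (`screenedLattice_window`, the shape of the
  tree fact `criticalTwoPoint_bounds` at `d = 3`).
  ⇒ LOAD-BEARING: a proof of r4 must use a property of the critical Ising MEASURE not in this list —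
  neither limit-side rigidity (Newman, Pitt–Kotani at `Δ = 1/2`: the limit here IS the free field) nor
  two-point decay/positivity/symmetry information can see the amplitude.
  Earlier seats (item evidence CruxAttack.lean, Mutation.lean): dropping `IsNondegenerateTwoPoint` or
  `HasPointwiseScalingLimit` collapses the crux to the open `¬ Screened` (killing renormalisation /
  constant family) — both load-bearing; not repeated here.
* (c) refuted strengthenings: `not_noGaussianMoebiusFamily` (no lattice at all: gff exists),
  `not_coulombWithoutIsing` (model-blind rev-3 strong form), `renorm_not_canonical` (the witness'
  `ρ²δ = 1 - log δ → ∞`: the screening sits entirely in the slowly varying factor of `ρ`).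
* (d) REFORMULATION (positive structural lemmas): `screened_iff_renorm` — under `hlim + hnd` alone,
  `Screened ↔ ρ(1/m)²/m → ∞` (MMS puts every direction on the axis, where `ρ(1/m)²G(me₁) → S₂(0,e₀)`);
  `screened_of_half_lt` — `Δ > 1/2 ⇒ Screened` (η = 2Δ-1 exists, tree `hasIsingExponentEta`);
  `dimension_window_and_eta` — `Δ ∈ [1/2, 3/4]`; hence **`crux_iff_half_and_amplitude`:
  `Crux ↔` every non-degenerate Möbius Gaussian limit has `Δ = 1/2` AND `Z_m := m/ρ(1/m)² ↛ 0`** —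
  the planner's halves (i) [= `GaussianLimitIsFree`-type, route AnomalousForcesInteraction item 2601]
  and (ii) [amplitude rigidity] as a Lean equivalence; `crux_of_halves` is the two-target form.
  HYPOTHESIS USAGE in (d): of `IsMoebiusCovariant` only `IsScaleCovariant` is used (Euclidean and
  inversion covariance are idle for the decomposition; a Markov/Pitt–Kotani proof of half (i) would use
  Euclidean invariance, nothing in sight uses inversion — cf. the rattack note); `hρ` enters only through
  the tree's window theorem and is morally redundant given `hlim + hnd` (they force `ρ(1/m)² → ∞`).
* (d2) `not_halfOne_blind` (witness `gffLattice (3/5)`: the sampled generalised free field) and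
  `not_halfTwo_blind` (witness `screenedLattice`: `ρ(1/m)²/m = 1 + log m → ∞`): EACH half is
  model-blind-false on its own, so each needs the Ising measure.

## (e) Paper-level examples bracketing the remaining lever (not formalised; for ideators)

(e1) MARKOV BUT NOT TRANSLATION INVARIANT — screened, GFF limit. Gaussian field on `ℤ³` with
precision `∇·a∇`, conductances `a(x) = A(|x|)` slowly varying, `A ↑ ∞` (e.g. `log(e+|x|)`). It is a
nearest-neighbour Gibbs/DLR (Markov) field; by Gauss' law `G(0,x) = ∫_{|x|}^∞ ds/(4πs²A(s))·(1+o(1))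
∼ (4π|x|A(|x|))⁻¹` — perfectly screened — while with `ρ(δ)² = A(1/δ)/δ` the pointwise limit of all
correlators is the massless free field (homogenisation at scale `1/δ`: `a = A(1/δ)(1+o(1))` on every
annulus `δ⁻¹[ε, ε⁻¹]`; the low-conductance core of radius `δ^{-1/2}` is a small inclusion, the far field
contributes `O(ε)`). So 'Markov inheritance + Pitt–Kotani (Δ = 1/2)' hold and do NOT see the
amplitude: TRANSLATION INVARIANCE of `⟨·⟩_{β_c}` is load-bearing.
(e2) TRANSLATION INVARIANT, RP/OS-POSITIVE, LATTICE-GAUSSIAN BUT NOT MARKOV — screened, GFF limit.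
Källén–Lehmann superposition `C = ∫ (−Δ_{ℤ³} + m²)⁻¹ dν(m)`, `ν` finite without atom at `0` but
`ν([0,m]) ≍ 1/log(1/m)`: `C(x) ∼ ν([0,1/|x|])/(4π|x|)` is screened, all lattice symmetries and
reflection positivity hold, the limit under `ρ² ∝ log(1/δ)/δ` is the free field; `Ĉ⁻¹` is not a
trigonometric polynomial, so the field is not n.n. Markov. (The Lean witness `screenedLattice` is the
cartoon of (e2) with an explicit kernel.) So RP + symmetries + lattice Gaussianity do NOT suffice:
the NEAREST-NEIGHBOUR DLR structure is load-bearing.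
(e3) For LATTICE-GAUSSIAN fields, (Markov ∧ translation invariant) ⇒ `Ĉ(p) = (Σᵢ aᵢ(2−2cos pᵢ))⁻¹`
at criticality ⇒ `C ∼ c/|x|`, `c > 0`: never screened — trivially. The whole difficulty of r4 is that
`criticalCorr 3` is NOT Gaussian on the lattice while Gaussian in the (hypothetical) limit: a proof
must transport the n.n. DLR equations of the ±1 spins to the limit WITH amplitude bookkeeping, i.e.
express `Z_m = m/ρ(1/m)²` (see (d)) through local observables. No translation-invariant n.n.-Markov
lattice field with a screened free limit is known to this seat; none is excluded either.
(e4) Interaction class: reflection-positive long-range models on `ℤ³` with `α < 3/2` are Gaussian AND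
screened (tree barrier `LongRangeTrivialityOnZ3` + `…PointwiseAudit`): interaction-uniform proofs die.

## HANDOFF for later cdisprove cycles
Landed/proposed: see NOTES.md of the seat (Negative/ModelBlind.lean = §1+(a1); Negative/Reformulation.lean
= (d); Negative/ModelBlindSharp.lean = (a2)+(c)+(d2) and Negative/ModelBlindAllOrders.lean = (a3) follow
once ModelBlind is in the tree). Targets: none yet (no line picked). Next regimes: (i) make (e2) a Lean
witness with genuine OS positivity if a prover proposes 'RP ⇒ not screened'; (ii) if a line posits
Markov inheritance, attack its amplitude step with (e1); (iii) if a line targets half (ii) through a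
lattice identity for `Z_m`, test that identity on `screenedLatticeAll` first (it must FAIL there, or the
identity cannot see the Ising measure).
-/

noncomputable section

namespace Summit.CriticalPhenomena.Ising3DConformalLimit.Cruxes.GaussianLimitNotScreened.Disproof

open Literature.Probability.LatticeModels Filter Topology Metric
open Literature.Barriers.CriticalPhenomena.ScaleNotMoebius (tendstoLocallyUniformlyOn_comp_approx
  dist_round_le norm_smul_toLp_latticeApprox_sub_le tendstoLocallyUniformlyOn_congr_eventually)

/-! ## The screened Wick witness on `ℤ³` -/

/-- The embedding `ℤ³ ↪ ℝ³`. [folklore] -/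
def ι (k : Site 3) : EuclideanSpace ℝ (Fin 3) := WithLp.toLp 2 fun j => (k j : ℝ)

/-- Coordinates of `ι`. [folklore] -/
@[simp] theorem ι_apply (k : Site 3) (j : Fin 3) : ι k j = (k j : ℝ) := rfl

/-- `ι 0 = 0`. [folklore] -/
@[simp] theorem ι_zero : ι (0 : Site 3) = 0 := by
  ext j; simp [ι]

/-- `ι` is additive (subtraction). [folklore] -/
theorem ι_sub (a b : Site 3) : ι (a - b) = ι a - ι b := by
  ext j; simp [ι]

/-- The screened radial profile `φ(r) = 1 / (r (1 + log r))` (junk `0` at `r = 0`). [folklore] -/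
def phi (r : ℝ) : ℝ := r⁻¹ * (1 + Real.log r)⁻¹

/-- The lattice pair kernel `g(a,b) = φ(‖a - b‖₂)`: `‖x‖₂⁻¹ (1 + log ‖x‖₂)⁻¹`, a perfectly
SCREENED Coulomb potential (`‖x‖ g → 0`) which is still regularly varying of index `-1`. [folklore] -/
def gL (a b : Site 3) : ℝ := phi ‖ι a - ι b‖

/-- The Wick (Gaussian) family generated by a pair kernel: `n = 2 ↦ K`, `n = 4 ↦` the three
pairings, every other arity `0`. [folklore] -/
def wickFamily {α : Type*} (K : α → α → ℝ) : (n : ℕ) → (Fin n → α) → ℝ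
  | 2, x => K (x 0) (x 1)
  | 4, x => K (x 0) (x 1) * K (x 2) (x 3) + K (x 0) (x 2) * K (x 1) (x 3) +
      K (x 0) (x 3) * K (x 1) (x 2)
  | _, _ => 0

/-- THE LATTICE WITNESS: the Wick family of the screened kernel `gL` on `ℤ³`. [folklore] -/
def screenedLattice : LatticeCorrFamily 3 := wickFamily gL

/-- Its renormalisation `ρ(δ) = √((1 - log δ)/δ)` (`= √(log(e/δ)/δ)`, i.e. `δ^{-1/2}` times a
slowly varying factor tending to `∞`). [folklore] -/
def renorm (δ : ℝ) : ℝ := Real.sqrt ((1 - Real.log δ) / δ)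

/-- The level-`L` comparison profile `ψ_L(R) = R⁻¹ · L/(L + log R)` (`→ R⁻¹` as `L → ∞`). [folklore] -/
def psi (L R : ℝ) : ℝ := R⁻¹ * (L * (L + Real.log R)⁻¹)

/-- `gffFamily Δ` is the Wick family of `gffTwo Δ`. [folklore] -/
theorem gffFamily_eq_wickFamily (Δ : ℝ) : gffFamily Δ = wickFamily (gffTwo Δ) := by
  funext n x
  match n with
  | 0 => rfl
  | 1 => rfl
  | 2 => rfl
  | 3 => rfl
  | 4 => rfl
  | _ + 5 => rfl

/-- `ρ(δ) > 0` on `(0,1]`. [folklore] -/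
theorem renorm_pos {δ : ℝ} (hδ : 0 < δ) (hδ1 : δ ≤ 1) : 0 < renorm δ := by
  unfold renorm
  apply Real.sqrt_pos.2
  have : Real.log δ ≤ 0 := Real.log_nonpos hδ.le hδ1
  exact div_pos (by linarith) hδ

/-- `ρ(δ)² = (1 - log δ)/δ` on `(0,1]`. [folklore] -/
theorem renorm_sq {δ : ℝ} (hδ : 0 < δ) (hδ1 : δ ≤ 1) : renorm δ ^ 2 = (1 - Real.log δ) / δ := by
  unfold renorm
  have : Real.log δ ≤ 0 := Real.log_nonpos hδ.le hδ1
  exact Real.sq_sqrt (div_nonneg (by linarith) hδ.le)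

/-- KEY ALGEBRA: `ρ(δ)² φ(r) = ψ_{1 - log δ}(δ r)` for `0 < δ ≤ 1` and every real `r`. [folklore] -/
theorem renorm_sq_mul_phi {δ : ℝ} (hδ : 0 < δ) (hδ1 : δ ≤ 1) (r : ℝ) :
    renorm δ ^ 2 * phi r = psi (1 - Real.log δ) (δ * r) := by
  rw [renorm_sq hδ hδ1, phi, psi]
  rcases eq_or_ne r 0 with rfl | hr
  · simp
  · rw [Real.log_mul hδ.ne' hr, mul_inv]
    field_simp
    ring

/-- The rescaled witness correlator at mesh `δ ∈ (0,1]` IS the level-`(1 - log δ)` comparison Wick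
family evaluated at the rounded configuration `δ[x/δ]`. [folklore] -/
theorem rescaledCorrelator_screenedLattice {δ : ℝ} (hδ : 0 < δ) (hδ1 : δ ≤ 1) (n : ℕ)
    (x : Fin n → EuclideanSpace ℝ (Fin 3)) :
    rescaledCorrelator screenedLattice renorm n δ x =
      wickFamily (fun a b : EuclideanSpace ℝ (Fin 3) => psi (1 - Real.log δ) ‖a - b‖) n
        (fun i => δ • ι (latticeApprox δ (x i))) := by
  have hpair : ∀ a b : Site 3, renorm δ ^ 2 * gL a b =
      psi (1 - Real.log δ) ‖δ • ι a - δ • ι b‖ := by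
    intro a b
    rw [gL, renorm_sq_mul_phi hδ hδ1, ← smul_sub, norm_smul, Real.norm_eq_abs, abs_of_pos hδ]
  rw [rescaledCorrelator_apply]
  match n with
  | 0 => simp [screenedLattice, wickFamily]
  | 1 => simp [screenedLattice, wickFamily]
  | 2 =>
    simp only [screenedLattice, wickFamily]
    rw [← hpair]
  | 3 => simp [screenedLattice, wickFamily]
  | 4 =>
    simp only [screenedLattice, wickFamily]
    rw [← hpair, ← hpair, ← hpair, ← hpair, ← hpair, ← hpair]
    ring
  | _ + 5 => simp [screenedLattice, wickFamily]

/-! ### The witness two-point function is perfectly screened -/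

/-- Sup norm ≤ Euclidean norm for integer points. [folklore] -/
theorem norm_le_norm_ι (x : Site 3) : ‖x‖ ≤ ‖ι x‖ := by
  rw [pi_norm_le_iff_of_nonneg (norm_nonneg _)]
  intro j
  have h : ‖(ι x) j‖ ≤ ‖ι x‖ := PiLp.norm_apply_le (ι x) j
  have e : ‖(ι x) j‖ = ‖x j‖ := by
    rw [ι_apply, Int.norm_cast_real]
  rwa [e] at h

/-- A nonzero integer point has Euclidean norm `≥ 1`. [folklore] -/
theorem one_le_norm_ι {x : Site 3} (hx : x ≠ 0) : 1 ≤ ‖ι x‖ := by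
  have h1 : (1 : ℝ) ≤ ‖x‖ := by
    obtain ⟨j, hj⟩ : ∃ j, x j ≠ 0 := by
      by_contra hall; push Not at hall; exact hx (funext hall)
    calc (1 : ℝ) ≤ ‖x j‖ := by
          rw [Int.norm_eq_abs]; exact_mod_cast Int.one_le_abs hj
      _ ≤ ‖x‖ := norm_le_pi_norm x j
  exact h1.trans (norm_le_norm_ι x)

/-- `G₂(0,x) = φ(‖x‖₂)`. [folklore] -/
theorem screenedLattice_two (x : Site 3) : screenedLattice 2 ![0, x] = phi ‖ι x‖ := by
  simp [screenedLattice, wickFamily, gL, norm_neg]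

/-- `‖x‖ · G₂(0,x) ≤ (1 + log ‖x‖)⁻¹` for `x ≠ 0`. [folklore] -/
theorem norm_mul_screenedLattice_two_le {x : Site 3} (hx : x ≠ 0) :
    ‖x‖ * screenedLattice 2 ![0, x] ≤ (1 + Real.log ‖x‖)⁻¹ := by
  rw [screenedLattice_two, phi]
  have h1 := one_le_norm_ι hx
  have hx1 : (1:ℝ) ≤ ‖x‖ := by
    obtain ⟨j, hj⟩ : ∃ j, x j ≠ 0 := by
      by_contra hall; push Not at hall; exact hx (funext hall)
    calc (1 : ℝ) ≤ ‖x j‖ := by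
          rw [Int.norm_eq_abs]; exact_mod_cast Int.one_le_abs hj
      _ ≤ ‖x‖ := norm_le_pi_norm x j
  have hlog0 : 0 ≤ Real.log ‖x‖ := Real.log_nonneg hx1
  have hlog : Real.log ‖x‖ ≤ Real.log ‖ι x‖ := Real.log_le_log (by linarith) (norm_le_norm_ι x)
  have hpos : 0 < ‖ι x‖ := by linarith
  calc ‖x‖ * (‖ι x‖⁻¹ * (1 + Real.log ‖ι x‖)⁻¹)
      = (‖x‖ / ‖ι x‖) * (1 + Real.log ‖ι x‖)⁻¹ := by ring
    _ ≤ 1 * (1 + Real.log ‖x‖)⁻¹ := by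
        have hA : ‖x‖ / ‖ι x‖ ≤ 1 := (div_le_one hpos).2 (norm_le_norm_ι x)
        have hB : (1 + Real.log ‖ι x‖)⁻¹ ≤ (1 + Real.log ‖x‖)⁻¹ :=
          inv_anti₀ (by linarith) (by linarith)
        have hC : 0 ≤ (1 + Real.log ‖ι x‖)⁻¹ := inv_nonneg.2 (by linarith)
        have hD : 0 ≤ ‖x‖ / ‖ι x‖ := by positivity
        nlinarith
    _ = (1 + Real.log ‖x‖)⁻¹ := one_mul _

/-- `G₂(0,x) ≥ 0`. [folklore] -/
theorem screenedLattice_two_nonneg (x : Site 3) : 0 ≤ screenedLattice 2 ![0, x] := by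
  rw [screenedLattice_two, phi]
  rcases eq_or_ne x 0 with rfl | hx
  · simp
  · have h1 := one_le_norm_ι hx
    have : 0 ≤ Real.log ‖ι x‖ := Real.log_nonneg h1
    positivity

/-- **The witness is perfectly screened**: `‖x‖ · G₂(0,x) → 0` along the cofinite filter of `ℤ³`. [folklore] -/
theorem screenedLattice_screened :
    Tendsto (fun x : Site 3 => ‖x‖ * screenedLattice 2 ![0, x]) cofinite (𝓝 0) := by
  have hlog : Tendsto (fun x : Site 3 => (1 + Real.log ‖x‖)⁻¹) cofinite (𝓝 0) := by
    have h1 : Tendsto (fun x : Site 3 => 1 + Real.log ‖x‖) cofinite atTop :=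
      tendsto_atTop_add_const_left _ 1
        (Real.tendsto_log_atTop.comp Site.tendsto_norm_cofinite_atTop)
    exact h1.inv_tendsto_atTop
  refine squeeze_zero' ?_ ?_ hlog
  · exact Eventually.of_forall fun x => mul_nonneg (norm_nonneg _) (screenedLattice_two_nonneg x)
  · have hne : ∀ᶠ x : Site 3 in cofinite, x ≠ 0 := by
      have : {x : Site 3 | x ≠ 0}ᶜ.Finite := by simp
      exact this
    exact hne.mono fun x hx => norm_mul_screenedLattice_two_le hx


/-! ### The scaling limit of the witness is the massless free field `gffFamily (1/2)` -/

/-- The level `1 - log δ → +∞` as `δ → 0⁺`. [folklore] -/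
theorem tendsto_level : Tendsto (fun δ : ℝ => 1 - Real.log δ) (𝓝[>] 0) atTop := by
  have h2 : Tendsto (fun δ : ℝ => -Real.log δ) (𝓝[>] 0) atTop :=
    tendsto_neg_atBot_atTop.comp Real.tendsto_log_nhdsGT_zero
  have h3 := tendsto_atTop_add_const_left _ (1:ℝ) h2
  simpa [sub_eq_add_neg] using h3

/-- The rounded configuration `δ[x/δ]`. [folklore] -/
def roundCfg {n : ℕ} (δ : ℝ) (x : Fin n → EuclideanSpace ℝ (Fin 3)) : Fin n → EuclideanSpace ℝ (Fin 3) :=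
  fun i => δ • ι (latticeApprox δ (x i))

/-- Rounding moves a configuration by at most `3δ`. [folklore] -/
theorem dist_roundCfg_le {n : ℕ} {δ : ℝ} (hδ : 0 < δ) (x : Fin n → EuclideanSpace ℝ (Fin 3)) :
    dist (roundCfg δ x) x ≤ 3 * δ :=
  dist_round_le hδ x

/-- Rounding moves each point by at most `3δ`. [folklore] -/
theorem norm_roundCfg_sub_le {n : ℕ} {δ : ℝ} (hδ : 0 < δ) (x : Fin n → EuclideanSpace ℝ (Fin 3))
    (i : Fin n) : ‖roundCfg δ x i - x i‖ ≤ 3 * δ :=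
  norm_smul_toLp_latticeApprox_sub_le hδ (x i)

/-- `x ↦ ‖xᵢ - xⱼ‖⁻¹` is continuous on non-coincident configurations. [folklore] -/
theorem continuousOn_inv_dist {n : ℕ} (i j : Fin n) (hij : i ≠ j) :
    ContinuousOn (fun x : Fin n → EuclideanSpace ℝ (Fin 3) => ‖x i - x j‖⁻¹) (NonCoincident 3 n) := by
  refine ContinuousOn.inv₀ (by fun_prop) fun x hx => ?_
  exact norm_ne_zero_iff.2 (sub_ne_zero.2 (((mem_nonCoincident x).1 hx).ne hij))

/-- (i) `‖δ[xᵢ/δ] - δ[xⱼ/δ]‖⁻¹ → ‖xᵢ - xⱼ‖⁻¹` locally uniformly. [folklore] -/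
theorem tendsto_inv_dist_round {n : ℕ} (i j : Fin n) (hij : i ≠ j) :
    TendstoLocallyUniformlyOn (fun δ x => ‖roundCfg δ x i - roundCfg δ x j‖⁻¹)
      (fun x : Fin n → EuclideanSpace ℝ (Fin 3) => ‖x i - x j‖⁻¹) (𝓝[>] 0) (NonCoincident 3 n) :=
  tendstoLocallyUniformlyOn_comp_approx (isOpen_nonCoincident 3 n)
    (f := fun x : Fin n → EuclideanSpace ℝ (Fin 3) => ‖x i - x j‖⁻¹)
    (continuousOn_inv_dist i j hij) (fun δ x => roundCfg δ x) 3 (fun _ hδ x => dist_roundCfg_le hδ x)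

/-- The logarithmic correction factor `q_L(R) = L/(L + log R)`. [folklore] -/
def qfac (L R : ℝ) : ℝ := L * (L + Real.log R)⁻¹

/-- `ψ_L(R) = R⁻¹ q_L(R)`. [folklore] -/
theorem psi_eq (L R : ℝ) : psi L R = R⁻¹ * qfac L R := rfl

/-- `|q_L(R) - 1| ≤ B/(L - B)` when `|log R| ≤ B < L`. [folklore] -/
theorem abs_qfac_sub_one_le {L R B : ℝ} (hB : |Real.log R| ≤ B) (hL : B < L) :
    |qfac L R - 1| ≤ B / (L - B) := by
  have hlo := neg_abs_le (Real.log R)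
  have hhi := le_abs_self (Real.log R)
  have hden : 0 < L + Real.log R := by linarith
  have hLB : 0 < L - B := by linarith
  have hq : qfac L R - 1 = -Real.log R / (L + Real.log R) := by
    unfold qfac
    field_simp
    ring
  rw [hq, abs_div, abs_neg, abs_of_pos hden, div_le_div_iff₀ hden hLB]
  have hB0 : 0 ≤ B := (abs_nonneg _).trans hB
  nlinarith [abs_nonneg (Real.log R)]

/-- (ii) `q_{1 - log δ}(‖δ[xᵢ/δ] - δ[xⱼ/δ]‖) → 1` locally uniformly on non-coincident
configurations (the slowly varying factor is invisible in the limit). [folklore] -/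
theorem tendsto_qfac_round {n : ℕ} (i j : Fin n) (hij : i ≠ j) :
    TendstoLocallyUniformlyOn
      (fun δ x => qfac (1 - Real.log δ) ‖roundCfg δ x i - roundCfg δ x j‖)
      (fun _ : Fin n → EuclideanSpace ℝ (Fin 3) => (1:ℝ)) (𝓝[>] 0) (NonCoincident 3 n) := by
  rw [Metric.tendstoLocallyUniformlyOn_iff]
  intro ε hε x₀ hx₀
  have hd0 : 0 < ‖x₀ i - x₀ j‖ :=
    norm_pos_iff.2 (sub_ne_zero.2 (((mem_nonCoincident x₀).1 hx₀).ne hij))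
  set d₀ := ‖x₀ i - x₀ j‖ with hd₀_def
  set t := {y : Fin n → EuclideanSpace ℝ (Fin 3) | ‖(y i - y j) - (x₀ i - x₀ j)‖ < d₀ / 2} with ht_def
  have ht_open : IsOpen t := isOpen_lt (by fun_prop) continuous_const
  have hx₀t : x₀ ∈ t := by
    show ‖(x₀ i - x₀ j) - (x₀ i - x₀ j)‖ < d₀ / 2
    rw [sub_self, norm_zero]; positivity
  refine ⟨t, mem_nhdsWithin_of_mem_nhds (ht_open.mem_nhds hx₀t), ?_⟩
  set B := max |Real.log (d₀ / 4)| |Real.log (2 * d₀)| with hB_def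
  have hB0 : 0 ≤ B := le_max_of_le_left (abs_nonneg _)
  have hev1 : ∀ᶠ δ in 𝓝[>] (0:ℝ), 0 < δ ∧ δ < d₀ / 24 := by
    filter_upwards [Ioo_mem_nhdsGT (show (0:ℝ) < d₀ / 24 by positivity)] with δ hδ
    exact ⟨hδ.1, hδ.2⟩
  have hev2 : ∀ᶠ δ in 𝓝[>] (0:ℝ), B + B / ε + 1 < 1 - Real.log δ :=
    tendsto_level.eventually_gt_atTop _
  filter_upwards [hev1, hev2] with δ hδ hL y hy
  obtain ⟨hδ0, hδd⟩ := hδ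
  -- the rounded pair distance R stays in [d₀/4, 2 d₀]
  set R := ‖roundCfg δ y i - roundCfg δ y j‖ with hR_def
  have hy' : ‖(y i - y j) - (x₀ i - x₀ j)‖ < d₀ / 2 := hy
  have hu_lo : d₀ / 2 < ‖y i - y j‖ := by
    have := norm_sub_norm_le (x₀ i - x₀ j) (y i - y j)
    rw [norm_sub_rev] at hy'
    linarith
  have hu_hi : ‖y i - y j‖ < 3 * d₀ / 2 := by
    have := norm_le_insert' (y i - y j) (x₀ i - x₀ j)
    linarith
  have hRi := norm_roundCfg_sub_le hδ0 y i
  have hRj := norm_roundCfg_sub_le hδ0 y j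
  have hRdiff : |R - ‖y i - y j‖| ≤ 6 * δ := by
    have h1 : |R - ‖y i - y j‖| ≤ ‖(roundCfg δ y i - roundCfg δ y j) - (y i - y j)‖ :=
      abs_norm_sub_norm_le _ _
    have h2 : ‖(roundCfg δ y i - roundCfg δ y j) - (y i - y j)‖ ≤ 3 * δ + 3 * δ := by
      calc ‖(roundCfg δ y i - roundCfg δ y j) - (y i - y j)‖
          = ‖(roundCfg δ y i - y i) - (roundCfg δ y j - y j)‖ := by congr 1; abel
        _ ≤ ‖roundCfg δ y i - y i‖ + ‖roundCfg δ y j - y j‖ := norm_sub_le _ _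
        _ ≤ 3 * δ + 3 * δ := add_le_add hRi hRj
    linarith
  have hRlo : d₀ / 4 ≤ R := by
    have := neg_abs_le (R - ‖y i - y j‖); linarith
  have hRhi : R ≤ 2 * d₀ := by
    have := le_abs_self (R - ‖y i - y j‖); linarith
  have hRpos : 0 < R := by linarith
  have hlogR : |Real.log R| ≤ B := by
    have h1 : Real.log (d₀ / 4) ≤ Real.log R := Real.log_le_log (by positivity) hRlo
    have h2 : Real.log R ≤ Real.log (2 * d₀) := Real.log_le_log hRpos hRhi
    exact abs_le_max_abs_abs h1 h2
  have hBL : B < 1 - Real.log δ := by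
    have : 0 ≤ B / ε := by positivity
    linarith
  rw [dist_comm, Real.dist_eq]
  calc |qfac (1 - Real.log δ) R - 1| ≤ B / (1 - Real.log δ - B) := abs_qfac_sub_one_le hlogR hBL
    _ < ε := by
        rw [div_lt_iff₀ (by linarith)]
        have h1 : B / ε < 1 - Real.log δ - B := by linarith
        have h2 := (div_lt_iff₀ hε).1 h1
        linarith

/-- (iii) The rescaled pair function converges: `ψ_{1-log δ}(‖δ[xᵢ/δ] - δ[xⱼ/δ]‖) → ‖xᵢ - xⱼ‖⁻¹`
locally uniformly on non-coincident configurations. [folklore] -/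
theorem tendsto_pair {n : ℕ} (i j : Fin n) (hij : i ≠ j) :
    TendstoLocallyUniformlyOn
      (fun δ x => psi (1 - Real.log δ) ‖roundCfg δ x i - roundCfg δ x j‖)
      (fun x : Fin n → EuclideanSpace ℝ (Fin 3) => ‖x i - x j‖⁻¹) (𝓝[>] 0) (NonCoincident 3 n) := by
  have h := (tendsto_inv_dist_round i j hij).mul₀ (tendsto_qfac_round i j hij)
    (continuousOn_inv_dist i j hij) continuousOn_const
  refine (h.congr fun δ x _ => ?_).congr_right fun x _ => ?_
  · simp only [Pi.mul_apply, psi_eq]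
  · simp only [Pi.mul_apply, mul_one]

/-- `gffTwo (1/2) a b = ‖a - b‖⁻¹`. [folklore] -/
theorem gffTwo_half (a b : EuclideanSpace ℝ (Fin 3)) : gffTwo (1/2) a b = ‖a - b‖⁻¹ := by
  rw [gffTwo, show (-(2 * (1/2 : ℝ))) = -1 by norm_num, Real.rpow_neg_one]

/-- `gffTwo 2⁻¹ a b = ‖a - b‖⁻¹` (simp-normal form of `gffTwo_half`). [folklore] -/
theorem gffTwo_half' (a b : EuclideanSpace ℝ (Fin 3)) : gffTwo 2⁻¹ a b = ‖a - b‖⁻¹ := by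
  rw [← gffTwo_half, one_div]

/-- **The screened lattice witness has the massless free field as pointwise scaling limit**:
`HasPointwiseScalingLimit screenedLattice renorm (gffFamily (1/2))`. [folklore] -/
theorem screenedLattice_hasLimit :
    HasPointwiseScalingLimit screenedLattice renorm (gffFamily (1/2)) := by
  intro n
  have hev : ∀ᶠ δ in 𝓝[>] (0:ℝ), Set.EqOn
      (fun x => wickFamily (fun a b : EuclideanSpace ℝ (Fin 3) => psi (1 - Real.log δ) ‖a - b‖) n
        (roundCfg δ x))
      (rescaledCorrelator screenedLattice renorm n δ) (NonCoincident 3 n) := by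
    filter_upwards [Ioc_mem_nhdsGT (zero_lt_one' ℝ)] with δ hδ x _
    exact (rescaledCorrelator_screenedLattice hδ.1 hδ.2 n x).symm
  refine tendstoLocallyUniformlyOn_congr_eventually ?_ hev
  have hzero : TendstoLocallyUniformlyOn (fun (_ : ℝ) (_ : Fin n → EuclideanSpace ℝ (Fin 3)) => (0:ℝ))
      (fun _ => 0) (𝓝[>] 0) (NonCoincident 3 n) :=
    ((tendsto_const_nhds (x := (0:ℝ))).tendstoUniformlyOn_const (NonCoincident 3 n)).tendstoLocallyUniformlyOn
  match n with
  | 0 => exact (hzero.congr fun δ x _ => by simp [wickFamily]).congr_right fun x _ => by simp [gffFamily]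
  | 1 => exact (hzero.congr fun δ x _ => by simp [wickFamily]).congr_right fun x _ => by simp [gffFamily]
  | 2 =>
    refine ((tendsto_pair (n := 2) 0 1 (by decide)).congr fun δ x _ => rfl).congr_right fun x _ => ?_
    simp [gffFamily, gffTwo_half']
  | 3 => exact (hzero.congr fun δ x _ => by simp [wickFamily]).congr_right fun x _ => by simp [gffFamily]
  | 4 =>
    have P := fun (i j : Fin 4) (hij : i ≠ j) => tendsto_pair (n := 4) i j hij
    have C := fun (i j : Fin 4) (hij : i ≠ j) => continuousOn_inv_dist (n := 4) i j hij
    have h := ((((P 0 1 (by decide)).mul₀ (P 2 3 (by decide)) (C 0 1 (by decide)) (C 2 3 (by decide))).add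
      ((P 0 2 (by decide)).mul₀ (P 1 3 (by decide)) (C 0 2 (by decide)) (C 1 3 (by decide)))).add
      ((P 0 3 (by decide)).mul₀ (P 1 2 (by decide)) (C 0 3 (by decide)) (C 1 2 (by decide))))
    refine (h.congr fun δ x _ => ?_).congr_right fun x _ => ?_
    · simp only [Pi.add_apply, Pi.mul_apply, wickFamily]
    · simp only [Pi.add_apply, Pi.mul_apply, gffFamily, gffTwo_half]
  | _ + 5 =>
    exact (hzero.congr fun δ x _ => by simp [wickFamily]).congr_right fun x _ => by simp [gffFamily]

/-! ## (a1) Load-bearing hypothesis №1: the lattice family must be `criticalCorr 3` itself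

The crux with the Ising correlators `criticalCorr 3` replaced by an ARBITRARY lattice family `G`
(and `criticalTwoPoint 3 x = criticalCorr 3 2 ![0,x]`, tree lemma `criticalCorr_two`, replaced by
`G 2 ![0,x]`). -/

/-- The model-blind form of the crux: for EVERY lattice family `G`, a non-degenerate Möbius-covariant
Gaussian pointwise scaling limit forbids perfect screening of `G₂`. [folklore] -/
def CruxWithoutIsing : Prop :=
  ∀ (G : LatticeCorrFamily 3) (ρ : ℝ → ℝ) (Δ : ℝ) (S : CorrFamily 3), (∀ δ ∈ Set.Ioc (0:ℝ) 1, 0 < ρ δ) →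
    HasPointwiseScalingLimit G ρ S → IsNondegenerateTwoPoint S → IsMoebiusCovariant Δ S →
    ¬ HasNontrivialU4 S →
    ¬ Tendsto (fun x : Site 3 => ‖x‖ * G 2 ![0, x]) cofinite (𝓝 0)

/-- The model-blind form implies the crux (instantiate `G := criticalCorr 3`). [folklore] -/
theorem crux_of_cruxWithoutIsing (h : CruxWithoutIsing) :
    Summit.CriticalPhenomena.Ising3DConformalLimit.Theses.PerfectScreening.GaussianLimitNotScreened := by
  intro ρ Δ S hρ hlim hnd hM hU4
  have := h (criticalCorr 3) ρ Δ S hρ hlim hnd hM hU4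
  simpa [criticalCorr_two] using this

/-- **`¬ CruxWithoutIsing` — any proof of the crux must use a property of the critical Ising
correlators beyond "having a non-degenerate, Möbius-covariant (Δ = 1/2), Gaussian pointwise scaling
limit".** Witness: the screened Wick family `screenedLattice` (`G₂(0,x) = ‖x‖₂⁻¹(1 + log ‖x‖₂)⁻¹`,
`G₄` = Wick, other arities `0`), renormalisation `ρ(δ) = √(log(e/δ)/δ)`, limit = the massless free
field `gffFamily (1/2)` (Möbius covariant, non-degenerate, `U₄ ≡ 0`), yet `‖x‖ G₂(0,x) → 0`. [folklore] -/
theorem cruxWithoutIsing_false : ¬ CruxWithoutIsing := by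
  intro h
  exact h screenedLattice renorm (1/2) (gffFamily (1/2)) (fun δ hδ => renorm_pos hδ.1 hδ.2)
    screenedLattice_hasLimit (isNondegenerateTwoPoint_gff _) (isMoebiusCovariant_gff _)
    (not_hasNontrivialU4_gff _) screenedLattice_screened


/-! ## (a2) Sharpened model-blindness: Ising-like two-point and algebraic structure does not help

The witness shares with `criticalCorr 3` every structural property that enters the route's
discussion of r4 at the two- and four-point level: lattice translation invariance, pair symmetry,
lattice Gaussianity (`U₄^{ℤ³} ≡ 0`, stronger than Gaussianity of the limit), vanishing odd
correlators, and the Simon–Lieb / infrared-bound window `c‖x‖⁻² ≤ G₂(0,x) ≤ C‖x‖⁻¹` of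
`criticalTwoPoint_bounds` (d = 3). So none of these can be the missing lever. -/

/-- `ι` is additive. [folklore] -/
theorem ι_add (a b : Site 3) : ι (a + b) = ι a + ι b := by
  ext j; simp [ι]

/-- The kernel is translation invariant. [folklore] -/
theorem gL_add (a b v : Site 3) : gL (a + v) (b + v) = gL a b := by
  simp only [gL, ι_add, add_sub_add_right_eq_sub]

/-- The kernel is symmetric. [folklore] -/
theorem gL_comm (a b : Site 3) : gL a b = gL b a := by
  rw [gL, gL, norm_sub_rev]

/-- Lattice translation invariance of the witness. [folklore] -/
theorem screenedLattice_translation (n : ℕ) (v : Site 3) (y : Fin n → Site 3) :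
    screenedLattice n (fun i => y i + v) = screenedLattice n y := by
  match n with
  | 0 => rfl
  | 1 => rfl
  | 2 => simp [screenedLattice, wickFamily, gL_add]
  | 3 => rfl
  | 4 => simp [screenedLattice, wickFamily, gL_add]
  | _ + 5 => rfl

/-- Pair symmetry of the witness. [folklore] -/
theorem screenedLattice_symm (a b : Site 3) : screenedLattice 2 ![a, b] = screenedLattice 2 ![b, a] := by
  simp [screenedLattice, wickFamily, gL_comm]

/-- Lattice Gaussianity of the witness: the Wick identity holds ON `ℤ³` (all configurations). [folklore] -/
theorem screenedLattice_wick (y : Fin 4 → Site 3) :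
    screenedLattice 4 y = screenedLattice 2 ![y 0, y 1] * screenedLattice 2 ![y 2, y 3] +
      screenedLattice 2 ![y 0, y 2] * screenedLattice 2 ![y 1, y 3] +
      screenedLattice 2 ![y 0, y 3] * screenedLattice 2 ![y 1, y 2] := by
  simp [screenedLattice, wickFamily]

/-- Odd correlators of the witness vanish. [folklore] -/
theorem screenedLattice_odd (n : ℕ) (hn : Odd n) (y : Fin n → Site 3) : screenedLattice n y = 0 := by
  match n, hn with
  | 0, hn => exact absurd hn (by decide)
  | 1, _ => rfl
  | 2, hn => exact absurd hn (by decide)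
  | 3, _ => rfl
  | 4, hn => exact absurd hn (by decide)
  | _ + 5, _ => rfl

/-- Euclidean norm ≤ √3 · sup norm for integer points (`‖ι x‖² ≤ 3‖x‖²`). [folklore] -/
theorem norm_ι_sq_le (x : Site 3) : ‖ι x‖ ^ 2 ≤ 3 * ‖x‖ ^ 2 := by
  rw [EuclideanSpace.norm_eq, Real.sq_sqrt (Finset.sum_nonneg fun _ _ => sq_nonneg _)]
  calc ∑ j, ‖(ι x) j‖ ^ 2 ≤ ∑ _j : Fin 3, ‖x‖ ^ 2 := by
        refine Finset.sum_le_sum fun j _ => ?_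
        have h : ‖(ι x) j‖ = ‖x j‖ := by rw [ι_apply, Int.norm_cast_real]
        rw [h]
        exact pow_le_pow_left₀ (norm_nonneg _) (norm_le_pi_norm x j) 2
    _ = 3 * ‖x‖ ^ 2 := by simp

/-- A nonzero integer point has sup norm `≥ 1`. [folklore] -/
theorem one_le_norm_of_ne_zero {x : Site 3} (hx : x ≠ 0) : (1:ℝ) ≤ ‖x‖ := by
  obtain ⟨j, hj⟩ : ∃ j, x j ≠ 0 := by
    by_contra hall; push Not at hall; exact hx (funext hall)
  calc (1 : ℝ) ≤ ‖x j‖ := by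
        rw [Int.norm_eq_abs]; exact_mod_cast Int.one_le_abs hj
    _ ≤ ‖x‖ := norm_le_pi_norm x j

/-- **The witness lies in the Ising two-point window** `(1/3)‖x‖⁻² ≤ G₂(0,x) ≤ ‖x‖⁻¹` (`x ≠ 0`,
sup norm, real powers) — the exact shape of the tree fact `criticalTwoPoint_bounds` at `d = 3`
(Simon–Lieb lower bound, Fröhlich–Simon–Spencer infrared upper bound). [folklore] -/
theorem screenedLattice_window :
    ∃ c C : ℝ, 0 < c ∧ ∀ x : Site 3, x ≠ 0 →
      c * ‖x‖ ^ (-(2:ℝ)) ≤ screenedLattice 2 ![0, x] ∧ screenedLattice 2 ![0, x] ≤ C * ‖x‖ ^ (-(1:ℝ)) := by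
  refine ⟨1/3, 1, by norm_num, fun x hx => ?_⟩
  have ht : (1:ℝ) ≤ ‖x‖ := one_le_norm_of_ne_zero hx
  have ht0 : (0:ℝ) < ‖x‖ := by linarith
  have hr1 : 1 ≤ ‖ι x‖ := one_le_norm_ι hx
  have hr0 : 0 < ‖ι x‖ := by linarith
  have hlog0 : 0 ≤ Real.log ‖ι x‖ := Real.log_nonneg hr1
  have hlog1 : 1 + Real.log ‖ι x‖ ≤ ‖ι x‖ := by
    have := Real.log_le_sub_one_of_pos hr0; linarith
  rw [screenedLattice_two, phi, Real.rpow_neg ht0.le, Real.rpow_two, Real.rpow_neg_one]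
  constructor
  · -- (1/3) (‖x‖²)⁻¹ ≤ r⁻¹ (1 + log r)⁻¹  ⟸  r (1 + log r) ≤ r² ≤ 3 ‖x‖²
    have hsq := norm_ι_sq_le x
    have hden : 0 < ‖ι x‖ * (1 + Real.log ‖ι x‖) := by positivity
    rw [← mul_inv, show (1/3 : ℝ) * (‖x‖ ^ 2)⁻¹ = (3 * ‖x‖ ^ 2)⁻¹ by rw [mul_inv]; norm_num]
    apply inv_anti₀ hden
    nlinarith
  · -- r⁻¹ (1 + log r)⁻¹ ≤ ‖x‖⁻¹
    have h1 : ‖ι x‖⁻¹ ≤ ‖x‖⁻¹ := inv_anti₀ ht0 (norm_le_norm_ι x)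
    have h2 : (1 + Real.log ‖ι x‖)⁻¹ ≤ 1 := inv_le_one_of_one_le₀ (by linarith)
    have h3 : 0 ≤ (1 + Real.log ‖ι x‖)⁻¹ := inv_nonneg.2 (by linarith)
    calc ‖ι x‖⁻¹ * (1 + Real.log ‖ι x‖)⁻¹ ≤ ‖x‖⁻¹ * 1 := by gcongr
      _ = 1 * ‖x‖⁻¹ := by ring

/-- The sharpened model-blind crux: as `CruxWithoutIsing`, but only for lattice families that are
translation invariant, pair-symmetric, Gaussian ON THE LATTICE (Wick identity at order 4), have
vanishing odd correlators and obey the Ising two-point window `c‖x‖⁻² ≤ G₂(0,x) ≤ C‖x‖⁻¹`. [folklore] -/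
def CruxWithoutIsingSharp : Prop :=
  ∀ (G : LatticeCorrFamily 3),
    (∀ n (v : Site 3) (y : Fin n → Site 3), G n (fun i => y i + v) = G n y) →
    (∀ a b : Site 3, G 2 ![a, b] = G 2 ![b, a]) →
    (∀ y : Fin 4 → Site 3, G 4 y = G 2 ![y 0, y 1] * G 2 ![y 2, y 3] +
      G 2 ![y 0, y 2] * G 2 ![y 1, y 3] + G 2 ![y 0, y 3] * G 2 ![y 1, y 2]) →
    (∀ n, Odd n → ∀ y : Fin n → Site 3, G n y = 0) →
    (∃ c C : ℝ, 0 < c ∧ ∀ x : Site 3, x ≠ 0 →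
      c * ‖x‖ ^ (-(2:ℝ)) ≤ G 2 ![0, x] ∧ G 2 ![0, x] ≤ C * ‖x‖ ^ (-(1:ℝ))) →
    ∀ (ρ : ℝ → ℝ) (Δ : ℝ) (S : CorrFamily 3), (∀ δ ∈ Set.Ioc (0:ℝ) 1, 0 < ρ δ) →
    HasPointwiseScalingLimit G ρ S → IsNondegenerateTwoPoint S → IsMoebiusCovariant Δ S →
    ¬ HasNontrivialU4 S →
    ¬ Tendsto (fun x : Site 3 => ‖x‖ * G 2 ![0, x]) cofinite (𝓝 0)

/-- `CruxWithoutIsing → CruxWithoutIsingSharp` (the sharp form has more hypotheses). [folklore] -/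
theorem cruxWithoutIsingSharp_of_cruxWithoutIsing (h : CruxWithoutIsing) : CruxWithoutIsingSharp :=
  fun G _ _ _ _ _ ρ Δ S hρ hlim hnd hM hU4 => h G ρ Δ S hρ hlim hnd hM hU4

/-- **`¬ CruxWithoutIsingSharp`**: even among translation-invariant, lattice-Gaussian, odd-free lattice
families inside the Ising two-point window, "non-degenerate Möbius Gaussian limit ⇒ not screened"
FAILS (same witness). So a proof of r4 must use something finer than: Gaussianity (on the lattice or
in the limit), Möbius covariance / `Δ = 1/2` rigidity of the limit, translation invariance, and the
Simon–Lieb/FSS decay window — i.e. exactly the 'amplitude rigidity' the planner flagged as having no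
known handle, which must come from the nearest-neighbour DLR structure of the Ising MEASURE. [folklore] -/
theorem cruxWithoutIsingSharp_false : ¬ CruxWithoutIsingSharp := by
  intro h
  exact h screenedLattice screenedLattice_translation screenedLattice_symm screenedLattice_wick
    screenedLattice_odd screenedLattice_window renorm (1/2) (gffFamily (1/2))
    (fun δ hδ => renorm_pos hδ.1 hδ.2) screenedLattice_hasLimit (isNondegenerateTwoPoint_gff _)
    (isMoebiusCovariant_gff _) (not_hasNontrivialU4_gff _) screenedLattice_screened

/-! ## (b) Logical position of the crux (pure logic; cf. CruxAttack.lean of the rattack seat) -/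

/-- Short name for the crux. [folklore] -/
abbrev Crux : Prop :=
  Summit.CriticalPhenomena.Ising3DConformalLimit.Theses.PerfectScreening.GaussianLimitNotScreened

/-- Perfect screening of the critical two-point function of the 3D Ising model (`Z = 0`). [folklore] -/
abbrev Screened : Prop :=
  Tendsto (fun x : Site 3 => ‖x‖ * criticalTwoPoint 3 x) cofinite (𝓝 0)

/-- Existence of a non-degenerate Möbius-covariant GAUSSIAN pointwise scaling limit of `criticalCorr 3`. [folklore] -/
abbrev GaussianMoebiusLimitExists : Prop :=
  ∃ (ρ : ℝ → ℝ) (Δ : ℝ) (S : CorrFamily 3), (∀ δ ∈ Set.Ioc (0:ℝ) 1, 0 < ρ δ) ∧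
    HasPointwiseScalingLimit (criticalCorr 3) ρ S ∧ IsNondegenerateTwoPoint S ∧
    IsMoebiusCovariant Δ S ∧ ¬ HasNontrivialU4 S

/-- The crux is `GaussianMoebiusLimitExists → ¬ Screened` (its conclusion ignores `(ρ, Δ, S)`). [folklore] -/
theorem crux_iff : Crux ↔ (GaussianMoebiusLimitExists → ¬ Screened) := by
  constructor
  · rintro h ⟨ρ, Δ, S, hρ, hlim, hnd, hM, hU4⟩
    exact h ρ Δ S hρ hlim hnd hM hU4
  · intro h ρ Δ S hρ hlim hnd hM hU4
    exact h ⟨ρ, Δ, S, hρ, hlim, hnd, hM, hU4⟩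

/-- Hence a REFUTATION of the crux is exactly `GaussianMoebiusLimitExists ∧ Screened` — the existence of
a free conformal limit of the 3D critical Ising model (believed false) together with `η > 0`-type
screening (open): no unconditional kill is available to a disprover. [folklore] -/
theorem not_crux_iff : ¬ Crux ↔ (GaussianMoebiusLimitExists ∧ Screened) := by
  rw [crux_iff]
  constructor
  · intro h
    by_contra h'
    exact h fun hA hB => h' ⟨hA, hB⟩
  · rintro ⟨hA, hB⟩ h
    exact h hA hB

/-- The crux follows from non-screening alone (`Z > 0`, i.e. `η = 0` with a two-sided Coulomb law
would give it) … [folklore] -/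
theorem crux_of_not_screened (h : ¬ Screened) : Crux := crux_iff.2 fun _ => h

/-- … and from the non-existence of a Gaussian Möbius limit alone (the physically expected reason:
then the crux holds VACUOUSLY). [folklore] -/
theorem crux_of_no_gaussian_limit (h : ¬ GaussianMoebiusLimitExists) : Crux :=
  crux_iff.2 fun h' => absurd h' h

/-- The rev-3 strong form (support item 1343 `GaussianLimitIsCoulomb`) implies the crux: a Coulomb
lower bound `c/‖x‖ ≤ G` is incompatible with `‖x‖ G → 0`. [folklore] -/
theorem crux_of_gaussianLimitIsCoulomb
    (h : Summit.CriticalPhenomena.Ising3DConformalLimit.Theses.PerfectScreening.GaussianLimitIsCoulomb) :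
    Crux := by
  intro ρ Δ S hρ hlim hnd hM hU4 hscr
  obtain ⟨c, hc, hcoul⟩ := h ρ Δ S hρ hlim hnd hM hU4
  have hev : ∀ᶠ x : Site 3 in cofinite, ‖x‖ * criticalTwoPoint 3 x < c :=
    (tendsto_order.1 hscr).2 c hc
  have hne : ∀ᶠ x : Site 3 in cofinite, x ≠ 0 := by
    have : {x : Site 3 | x ≠ 0}ᶜ.Finite := by simp
    exact this
  obtain ⟨x, hx, hx0⟩ := (hev.and hne).exists
  have hxn : 0 < ‖x‖ := norm_pos_iff.2 hx0
  have := hcoul x hx0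
  rw [div_le_iff₀ hxn] at this
  linarith [mul_comm ‖x‖ (criticalTwoPoint 3 x)]

/-- With perfect screening and the imported complement `MoebiusLimitExists` (r5), the crux closes the
conjunct `Ising3DConformalLimit` on its own: on the screened branch r4 IS clause (iii). [folklore] -/
theorem conjunct_of_crux_screened (h : Crux) (hscr : Screened)
    (hM : Summit.CriticalPhenomena.Ising3DConformalLimit.Theses.PerfectScreening.MoebiusLimitExists) :
    _root_.Ising3DConformalLimit := by
  obtain ⟨ρ, Δ, S, hρ, hΔ, hlim, hnd, hMo⟩ := hM
  refine ⟨ρ, Δ, S, hρ, hΔ, hlim, hnd, hMo, ?_⟩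
  by_contra hU4
  exact h ρ Δ S hρ hlim hnd hMo hU4 hscr

/-! ## (c) Natural strengthenings, refuted -/

/-- STRENGTHENING 1 (drop the lattice altogether): "no non-degenerate Möbius-covariant family with
`U₄ ≡ 0` exists" is FALSE — the generalised free field (tree `exists_moebius_nondegenerate_gaussian`). [folklore] -/
theorem not_noGaussianMoebiusFamily :
    ¬ ∀ (Δ : ℝ) (S : CorrFamily 3), 0 < Δ → IsNondegenerateTwoPoint S → IsMoebiusCovariant Δ S →
      HasNontrivialU4 S := by
  intro h
  obtain ⟨Δ, S, hΔ, hnd, hM, hU4⟩ := exists_moebius_nondegenerate_gaussian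
  exact hU4 (h Δ S hΔ hnd hM)

/-- STRENGTHENING 2 (model-blind rev-3 strong form): the model-blind `GaussianLimitIsCoulomb`
(conclusion `∃ c > 0, c/‖x‖ ≤ G₂(0,x)`) is FALSE as well (it implies the model-blind crux). [folklore] -/
theorem not_coulombWithoutIsing :
    ¬ ∀ (G : LatticeCorrFamily 3) (ρ : ℝ → ℝ) (Δ : ℝ) (S : CorrFamily 3), (∀ δ ∈ Set.Ioc (0:ℝ) 1, 0 < ρ δ) →
      HasPointwiseScalingLimit G ρ S → IsNondegenerateTwoPoint S → IsMoebiusCovariant Δ S →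
      ¬ HasNontrivialU4 S → ∃ c : ℝ, 0 < c ∧ ∀ x : Site 3, x ≠ 0 → c / ‖x‖ ≤ G 2 ![0, x] := by
  intro h
  obtain ⟨c, hc, hcoul⟩ := h screenedLattice renorm (1/2) (gffFamily (1/2))
    (fun δ hδ => renorm_pos hδ.1 hδ.2) screenedLattice_hasLimit (isNondegenerateTwoPoint_gff _)
    (isMoebiusCovariant_gff _) (not_hasNontrivialU4_gff _)
  have hev : ∀ᶠ x : Site 3 in cofinite, ‖x‖ * screenedLattice 2 ![0, x] < c :=
    (tendsto_order.1 screenedLattice_screened).2 c hc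
  have hne : ∀ᶠ x : Site 3 in cofinite, x ≠ 0 := by
    have : {x : Site 3 | x ≠ 0}ᶜ.Finite := by simp
    exact this
  obtain ⟨x, hx, hx0⟩ := (hev.and hne).exists
  have hxn : 0 < ‖x‖ := norm_pos_iff.2 hx0
  have := hcoul x hx0
  rw [div_le_iff₀ hxn] at this
  linarith [mul_comm ‖x‖ (screenedLattice 2 ![0, x])]

/-- STRENGTHENING 3 (drop `Δ`-freedom: insist on the canonical `Δ = 1/2` AND `ρ δ = δ^{-1/2}` exactly):
with the CANONICAL renormalisation the model-blind statement becomes TRUE trivially-by-contrapositive?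
No — record instead the positive fact behind the crux's last step: if `ρ δ = δ^{-1/2}` is admissible
for the witness' limit then the two-point function is NOT screened. For `screenedLattice` the canonical
renormalisation gives the ZERO two-point limit (the amplitude `(1 + log(r/δ))⁻¹ → 0`), i.e. the
screening is carried entirely by the slowly varying factor `√(log(e/δ))` in `renorm`. [folklore] -/
theorem renorm_not_canonical :
    Tendsto (fun δ : ℝ => renorm δ ^ 2 / δ⁻¹) (𝓝[>] 0) atTop := by
  have hev : ∀ᶠ δ in 𝓝[>] (0:ℝ), renorm δ ^ 2 / δ⁻¹ = 1 - Real.log δ := by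
    filter_upwards [Ioc_mem_nhdsGT (zero_lt_one' ℝ)] with δ hδ
    rw [renorm_sq hδ.1 hδ.2, div_inv_eq_mul, div_mul_cancel₀ _ hδ.1.ne']
  exact (tendsto_level.congr' (hev.mono fun δ h => h.symm))


/-! ## (d) Reformulation: the conclusion is a property of `ρ` alone; r4 = (Δ = 1/2) ∧ (amplitude)

Positive structural lemmas for provers (no Theses decl asserted). With `Z_m := m / ρ(1/m)²` (the
'wave-function renormalisation' read at the lattice pair `(0, m e₁)`):
* `screened_iff_renorm`: under `hlim + hnd` alone, perfect screening `‖x‖G → 0` is EQUIVALENT to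
  `ρ(1/m)²/m → ∞` (`Z_m → 0`) — Messager–Miracle-Solé moves every direction onto the axis, and on
  the axis `ρ(1/m)² G(m e₁) → S₂(0,e₀) > 0`.
* `screened_of_half_lt`: under `hlim + hnd + hρ + scale covariance`, `Δ > 1/2` already forces perfect
  screening (η = 2Δ - 1 > 0 exists by the tree's `hasIsingExponentEta`).
* `crux_iff_half_and_amplitude`: hence the crux is EXACTLY "every non-degenerate Möbius Gaussian
  limit of `criticalCorr 3` has `Δ = 1/2` AND `Z_m ↛ 0`" — the planner's split (i) ∧ (ii) as a Lean
  equivalence; half (i) is the Markov/Pitt–Kotani statement shared with `GaussianLimitIsFree`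
  (route AnomalousForcesInteraction), half (ii) is the amplitude rigidity with no known handle. -/

section Reformulation

variable {ρ : ℝ → ℝ} {Δ : ℝ} {S : CorrFamily 3}

/-- `S₂(0, e₀) > 0` for a non-degenerate family. [folklore] -/
theorem refPair_pos (hnd : IsNondegenerateTwoPoint S) :
    0 < S 2 ![0, EuclideanSpace.single (0 : Fin 3) (1:ℝ)] := by
  have hx₀ := refPair_mem_nonCoincident (d := 3) (by norm_num)
  have e0 : (⟨0, by norm_num⟩ : Fin 3) = 0 := rfl
  rw [e0] at hx₀
  exact hnd _ hx₀

/-- `‖y‖_∞ → ∞` along the cofinite filter of `ℤ³` (ℕ-valued form). [folklore] -/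
theorem tendsto_supNorm_cofinite : Tendsto (fun y : Site 3 => Site.supNorm y) cofinite atTop := by
  have h := Site.tendsto_norm_cofinite_atTop (d := 3)
  simp_rw [Site.norm_eq_supNorm] at h
  exact tendsto_natCast_atTop_iff.1 h

/-- Perfect screening read on the axis: `m ⟨σ₀σ_{m e₁}⟩ → 0`. [folklore] -/
theorem tendsto_axis_of_screened (h : Screened) :
    Tendsto (fun m : ℕ => (m:ℝ) * criticalTwoPoint 3 (Pi.single 0 (m:ℤ))) atTop (𝓝 0) := by
  have hinj : Function.Injective (fun m : ℕ => (Pi.single 0 (m:ℤ) : Site 3)) := by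
    intro a b hab
    have := congr_fun hab 0
    simpa using this
  have h1 := h.comp (hinj.tendsto_cofinite.mono_left Nat.cofinite_eq_atTop.ge)
  refine h1.congr' (Eventually.of_forall fun m => ?_)
  simp only [Function.comp_apply, norm_single_axis, Int.cast_natCast, Nat.abs_cast]

/-- Conversely the axis controls every direction (MMS): `m ⟨σ₀σ_{m e₁}⟩ → 0 ⇒ ‖x‖G(x) → 0`. [folklore] -/
theorem screened_of_tendsto_axis
    (hax : Tendsto (fun m : ℕ => (m:ℝ) * criticalTwoPoint 3 (Pi.single 0 (m:ℤ))) atTop (𝓝 0)) :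
    Screened := by
  have hup := hax.comp tendsto_supNorm_cofinite
  refine squeeze_zero' (Eventually.of_forall fun y =>
    mul_nonneg (norm_nonneg _) (criticalTwoPoint_nonneg' _)) ?_ hup
  filter_upwards [tendsto_supNorm_cofinite.eventually (eventually_ge_atTop 1)] with y hy
  obtain ⟨-, hle⟩ := criticalTwoPoint_axis_sandwich hy
  rw [Function.comp_apply, Site.norm_eq_supNorm]
  exact mul_le_mul_of_nonneg_left hle (Nat.cast_nonneg _)

/-- **Screening is a property of the renormalisation alone.** For a non-degenerate pointwise limit
`(ρ, S)` of `criticalCorr 3`: `‖x‖⟨σ₀σ_x⟩_{β_c} → 0 ↔ ρ(1/m)²/m → ∞` (i.e. `Z_m := m/ρ(1/m)² → 0`).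
[folklore] -/
theorem screened_iff_renorm (hlim : HasPointwiseScalingLimit (criticalCorr 3) ρ S)
    (hnd : IsNondegenerateTwoPoint S) :
    Screened ↔ Tendsto (fun m : ℕ => ρ (1 / m) ^ 2 / m) atTop atTop := by
  have hA := hlim.tendsto_renorm_sq_mul_axis
  have hs := refPair_pos hnd
  constructor
  · intro hscr
    have hB := tendsto_axis_of_screened hscr
    have hBpos : ∀ᶠ m : ℕ in atTop, 0 < (m:ℝ) * criticalTwoPoint 3 (Pi.single 0 (m:ℤ)) := by
      filter_upwards [eventually_ge_atTop 1] with m hm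
      exact mul_pos (by exact_mod_cast hm) (criticalTwoPoint_axis_pos m)
    have hBinv : Tendsto (fun m : ℕ => ((m:ℝ) * criticalTwoPoint 3 (Pi.single 0 (m:ℤ)))⁻¹) atTop atTop :=
      tendsto_inv_nhdsGT_zero.comp (tendsto_nhdsWithin_iff.2 ⟨hB, hBpos⟩)
    refine (hA.pos_mul_atTop hs hBinv).congr' ?_
    filter_upwards [eventually_ge_atTop 1] with m hm
    have hG := (criticalTwoPoint_axis_pos m).ne'
    have hm' : (m:ℝ) ≠ 0 := by positivity
    field_simp
  · intro hT
    have h0 := hA.div_atTop hT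
    apply screened_of_tendsto_axis
    refine h0.congr' ?_
    filter_upwards [hT.eventually_gt_atTop 0, eventually_ge_atTop 1] with m hpos hm
    have hρ : ρ (1 / m) ^ 2 ≠ 0 := by
      intro h; rw [h, zero_div] at hpos; exact lt_irrefl _ hpos
    have hρ' : ρ (1 / m) ≠ 0 := fun h => hρ (by rw [h]; ring)
    have hm' : (m:ℝ) ≠ 0 := by positivity
    field_simp

/-- The scaling dimension of a non-degenerate scale-covariant pointwise limit of `criticalCorr 3` lies
in `[1/2, 3/4]` and `η = 2Δ - 1` exists (tree: `exists_rpow_scale_mem_Icc_threeQuarters`, with the two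
exponents identified at the reference pair). [cite: DuminilCopinPanis2025LowerBounds, Theorem 1.5] -/
theorem dimension_window_and_eta (hρ : ∀ δ ∈ Set.Ioc (0:ℝ) 1, 0 < ρ δ)
    (hlim : HasPointwiseScalingLimit (criticalCorr 3) ρ S) (hnd : IsNondegenerateTwoPoint S)
    (hsc : IsScaleCovariant Δ S) :
    Δ ∈ Set.Icc (1/2 : ℝ) (3/4) ∧ HasIsingExponentEta 3 (2 * Δ - 1) := by
  obtain ⟨Δ', hΔ', hcov, -, hη⟩ := hlim.exists_rpow_scale_mem_Icc_threeQuarters hρ hnd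
  have hx₀ := refPair_mem_nonCoincident (d := 3) (by norm_num)
  set x₀ : Fin 2 → EuclideanSpace ℝ (Fin 3) := ![0, EuclideanSpace.single (⟨0, by norm_num⟩ : Fin 3) (1:ℝ)]
  have ha : 0 < S 2 x₀ := hnd _ hx₀
  have heq : Δ = Δ' := by
    have e₁ := hsc 2 2 two_pos x₀
    have e₂ := hcov 2 2 two_pos x₀ hx₀
    rw [e₁] at e₂
    have h := mul_right_cancel₀ ha.ne' e₂
    have h' := congrArg Real.log h
    rw [Real.log_rpow two_pos, Real.log_rpow two_pos] at h'
    have hl : Real.log 2 ≠ 0 := (Real.log_pos one_lt_two).ne'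
    have := mul_right_cancel₀ hl h'
    push_cast at this
    linarith
  subst heq
  exact ⟨hΔ', hη⟩

/-- **`Δ > 1/2` is automatically screened.** If a non-degenerate pointwise limit of `criticalCorr 3`
is scale covariant with `Δ > 1/2`, then `‖x‖⟨σ₀σ_x⟩_{β_c} → 0` (since `η = 2Δ - 1 > 0` exists in
the logarithmic sense). So on the screened branch the crux only ever has to exclude `Δ = 1/2`. [folklore] -/
theorem screened_of_half_lt (hρ : ∀ δ ∈ Set.Ioc (0:ℝ) 1, 0 < ρ δ)
    (hlim : HasPointwiseScalingLimit (criticalCorr 3) ρ S) (hnd : IsNondegenerateTwoPoint S)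
    (hsc : IsScaleCovariant Δ S) (hΔ : 1/2 < Δ) : Screened := by
  obtain ⟨-, hη⟩ := dimension_window_and_eta hρ hlim hnd hsc
  -- hη : log G(y) / log ‖y‖ → -(3 - 2 + (2Δ - 1)) = -2Δ
  unfold HasIsingExponentEta HasSpatialDecayExponent at hη
  have hlim' : Tendsto (fun y : Site 3 => Real.log (criticalTwoPoint 3 y) / Real.log ‖y‖) cofinite
      (𝓝 (-(2 * Δ))) := by
    convert hη using 2; push_cast; ring
  obtain ⟨κ, hκ1, hκ2⟩ : ∃ κ : ℝ, 1 < κ ∧ κ < 2 * Δ := ⟨(1 + 2 * Δ) / 2, by linarith, by linarith⟩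
  have hnorm := Site.tendsto_norm_cofinite_atTop (d := 3)
  have hev1 : ∀ᶠ y : Site 3 in cofinite, Real.log (criticalTwoPoint 3 y) / Real.log ‖y‖ < -κ :=
    (tendsto_order.1 hlim').2 _ (by linarith)
  have hev2 : ∀ᶠ y : Site 3 in cofinite, 1 < ‖y‖ := hnorm.eventually (eventually_gt_atTop 1)
  -- the majorant ‖y‖^{1-κ} → 0
  have hmaj : Tendsto (fun y : Site 3 => ‖y‖ ^ (1 - κ)) cofinite (𝓝 0) := by
    have := (tendsto_rpow_neg_atTop (by linarith : 0 < κ - 1)).comp hnorm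
    refine this.congr' (Eventually.of_forall fun y => ?_)
    simp only [Function.comp_apply, neg_sub]
  refine squeeze_zero' (Eventually.of_forall fun y =>
    mul_nonneg (norm_nonneg _) (criticalTwoPoint_nonneg' _)) ?_ hmaj
  filter_upwards [hev1, hev2] with y h1 h2
  have hy0 : y ≠ 0 := by
    intro h; rw [h, norm_zero] at h2; linarith
  have hlog : 0 < Real.log ‖y‖ := Real.log_pos h2
  have hGpos : 0 < criticalTwoPoint 3 y := by
    obtain ⟨c, C, hc, hbd⟩ := criticalTwoPoint_bounds_holds (d := 3) le_rfl
    exact lt_of_lt_of_le (mul_pos hc (Real.rpow_pos_of_pos (by linarith) _)) (hbd y hy0).1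
  have h3 : Real.log (criticalTwoPoint 3 y) < -κ * Real.log ‖y‖ := by
    rwa [div_lt_iff₀ hlog] at h1
  have h4 : criticalTwoPoint 3 y < ‖y‖ ^ (-κ) := by
    rw [← Real.log_lt_log_iff hGpos (Real.rpow_pos_of_pos (by linarith) _), Real.log_rpow (by linarith)]
    exact h3
  have hn0 : (0:ℝ) < ‖y‖ := by linarith
  calc ‖y‖ * criticalTwoPoint 3 y ≤ ‖y‖ * ‖y‖ ^ (-κ) := by gcongr
    _ = ‖y‖ ^ (1 - κ) := by
        rw [sub_eq_add_neg, Real.rpow_add hn0, Real.rpow_one]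

/-- **THE CRUX, DECOMPOSED.** `GaussianLimitNotScreened ↔` every non-degenerate Möbius-covariant
Gaussian pointwise limit `(ρ, Δ, S)` of `criticalCorr 3` has (i) `Δ = 1/2` and (ii) its wave-function
renormalisation `Z_m = m/ρ(1/m)²` does NOT tend to `0` (`¬ ρ(1/m)²/m → ∞`). [folklore] -/
theorem crux_iff_half_and_amplitude :
    Crux ↔ ∀ (ρ : ℝ → ℝ) (Δ : ℝ) (S : CorrFamily 3), (∀ δ ∈ Set.Ioc (0:ℝ) 1, 0 < ρ δ) →
      HasPointwiseScalingLimit (criticalCorr 3) ρ S → IsNondegenerateTwoPoint S →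
      IsMoebiusCovariant Δ S → ¬ HasNontrivialU4 S →
      (Δ = 1/2 ∧ ¬ Tendsto (fun m : ℕ => ρ (1 / m) ^ 2 / m) atTop atTop) := by
  constructor
  · intro h ρ Δ S hρ hlim hnd hM hU4
    have hns : ¬ Screened := h ρ Δ S hρ hlim hnd hM hU4
    refine ⟨?_, fun hT => hns ((screened_iff_renorm hlim hnd).2 hT)⟩
    obtain ⟨hwin, -⟩ := dimension_window_and_eta hρ hlim hnd hM.isScaleCovariant
    by_contra hne
    have hlt : 1/2 < Δ := lt_of_le_of_ne hwin.1 (Ne.symm hne)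
    exact hns (screened_of_half_lt hρ hlim hnd hM.isScaleCovariant hlt)
  · intro h ρ Δ S hρ hlim hnd hM hU4 hscr
    obtain ⟨-, hT⟩ := h ρ Δ S hρ hlim hnd hM hU4
    exact hT ((screened_iff_renorm hlim hnd).1 hscr)

/-- In particular the crux would follow from 'a Gaussian Möbius limit has `Δ = 1/2`' (half (i)) plus
'at `Δ = 1/2` the renormalisation is `O(δ^{-1/2})` along the integer meshes' (half (ii)). Recorded as the
two-hypothesis form provers can target separately. [folklore] -/
theorem crux_of_halves
    (h_half : ∀ (ρ : ℝ → ℝ) (Δ : ℝ) (S : CorrFamily 3), (∀ δ ∈ Set.Ioc (0:ℝ) 1, 0 < ρ δ) →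
      HasPointwiseScalingLimit (criticalCorr 3) ρ S → IsNondegenerateTwoPoint S →
      IsMoebiusCovariant Δ S → ¬ HasNontrivialU4 S → Δ = 1/2)
    (h_amp : ∀ (ρ : ℝ → ℝ) (S : CorrFamily 3), (∀ δ ∈ Set.Ioc (0:ℝ) 1, 0 < ρ δ) →
      HasPointwiseScalingLimit (criticalCorr 3) ρ S → IsNondegenerateTwoPoint S →
      IsMoebiusCovariant (1/2) S → ¬ HasNontrivialU4 S →
      ¬ Tendsto (fun m : ℕ => ρ (1 / m) ^ 2 / m) atTop atTop) : Crux := by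
  rw [crux_iff_half_and_amplitude]
  intro ρ Δ S hρ hlim hnd hM hU4
  have hΔ := h_half ρ Δ S hρ hlim hnd hM hU4
  subst hΔ
  exact ⟨rfl, h_amp ρ S hρ hlim hnd hM hU4⟩

end Reformulation


/-! ## (d2) Both halves of the decomposition are individually MODEL-BLIND-FALSE

Half (i) ('a Gaussian Möbius limit has `Δ = 1/2`') fails for the lattice sampling of the generalised
free field `gffFamily Δ`, `Δ ∈ (1/2, 3/4)` (the LongRangeTrivialityOnZ3 phenomenon in its barest form);
half (ii) ('at `Δ = 1/2`, `Z_m ↛ 0`') fails for `screenedLattice`. So EACH half needs the Ising measure. -/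

/-- The generalised free field sampled on `ℤ³`. [folklore] -/
def gffLattice (Δ : ℝ) : LatticeCorrFamily 3 := fun n y => gffFamily Δ n fun i => ι (y i)

/-- `gffTwo Δ` of a pair picked from a configuration is continuous off the diagonals. [folklore] -/
theorem continuousOn_gffTwo_pair (Δ : ℝ) {n : ℕ} {i j : Fin n} (hij : i ≠ j) :
    ContinuousOn (fun z : Fin n → EuclideanSpace ℝ (Fin 3) => gffTwo Δ (z i) (z j)) (NonCoincident 3 n) := by
  unfold gffTwo
  refine ContinuousOn.rpow_const (((continuous_apply i).sub (continuous_apply j)).norm.continuousOn) ?_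
  intro z hz
  exact Or.inl (norm_ne_zero_iff.2 (sub_ne_zero.2 fun h => hij (((mem_nonCoincident z).1 hz) h)))

/-- The generalised free family is continuous on non-coincident configurations. [folklore] -/
theorem continuousOn_gffFamily (Δ : ℝ) : ∀ n, ContinuousOn (gffFamily Δ n) (NonCoincident 3 n)
  | 0 => continuousOn_const
  | 1 => continuousOn_const
  | 2 => continuousOn_gffTwo_pair Δ (by decide : (0 : Fin 2) ≠ 1)
  | 3 => continuousOn_const
  | 4 => ((continuousOn_gffTwo_pair Δ (by decide : (0 : Fin 4) ≠ 1)).mul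
        (continuousOn_gffTwo_pair Δ (by decide : (2 : Fin 4) ≠ 3))).add
      ((continuousOn_gffTwo_pair Δ (by decide : (0 : Fin 4) ≠ 2)).mul
        (continuousOn_gffTwo_pair Δ (by decide : (1 : Fin 4) ≠ 3))) |>.add
      ((continuousOn_gffTwo_pair Δ (by decide : (0 : Fin 4) ≠ 3)).mul
        (continuousOn_gffTwo_pair Δ (by decide : (1 : Fin 4) ≠ 2)))
  | _ + 5 => continuousOn_const

/-- The sampled generalised free field has itself as pointwise scaling limit (`ρ δ = δ^{-Δ}`). [folklore] -/
theorem gffLattice_hasLimit (Δ : ℝ) :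
    HasPointwiseScalingLimit (gffLattice Δ) (fun δ => δ ^ (-Δ)) (gffFamily Δ) := by
  intro n
  have key : ∀ δ, 0 < δ → ∀ x : Fin n → EuclideanSpace ℝ (Fin 3),
      rescaledCorrelator (gffLattice Δ) (fun δ => δ ^ (-Δ)) n δ x = gffFamily Δ n (roundCfg δ x) := by
    intro δ hδ x
    rw [rescaledCorrelator_apply]
    show (δ ^ (-Δ)) ^ n * gffFamily Δ n (fun i => ι (latticeApprox δ (x i))) =
      gffFamily Δ n (fun i => δ • ι (latticeApprox δ (x i)))
    rw [isScaleCovariant_gff Δ n δ hδ]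
    congr 1
    rw [← Real.rpow_natCast, ← Real.rpow_mul hδ.le]
    congr 1; ring
  have happrox := tendstoLocallyUniformlyOn_comp_approx (isOpen_nonCoincident 3 n)
    (continuousOn_gffFamily Δ n) (fun δ x => roundCfg δ x) 3 (fun _ hδ x => dist_roundCfg_le hδ x)
  refine tendstoLocallyUniformlyOn_congr_eventually happrox ?_
  filter_upwards [self_mem_nhdsWithin] with δ hδ x _
  exact (key δ hδ x).symm

/-- **Half (i) is model-blind-false**: a non-degenerate Möbius Gaussian pointwise limit of a lattice
family need not have `Δ = 1/2` (witness: `gffLattice (3/5)`, inside the Ising window `[1/2, 3/4]`). [folklore] -/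
theorem not_halfOne_blind :
    ¬ ∀ (G : LatticeCorrFamily 3) (ρ : ℝ → ℝ) (Δ : ℝ) (S : CorrFamily 3), (∀ δ ∈ Set.Ioc (0:ℝ) 1, 0 < ρ δ) →
      HasPointwiseScalingLimit G ρ S → IsNondegenerateTwoPoint S → IsMoebiusCovariant Δ S →
      ¬ HasNontrivialU4 S → Δ = 1/2 := by
  intro h
  have := h (gffLattice (3/5)) (fun δ => δ ^ (-(3/5:ℝ))) (3/5) (gffFamily (3/5))
    (fun δ hδ => Real.rpow_pos_of_pos hδ.1 _) (gffLattice_hasLimit _) (isNondegenerateTwoPoint_gff _)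
    (isMoebiusCovariant_gff _) (not_hasNontrivialU4_gff _)
  norm_num at this

/-- **Half (ii) is model-blind-false**: at `Δ = 1/2`, a non-degenerate Möbius Gaussian pointwise limit of
a lattice family may come with `ρ(1/m)²/m → ∞` (witness: `screenedLattice`, `ρ(1/m)²/m = 1 + log m`). [folklore] -/
theorem not_halfTwo_blind :
    ¬ ∀ (G : LatticeCorrFamily 3) (ρ : ℝ → ℝ) (S : CorrFamily 3), (∀ δ ∈ Set.Ioc (0:ℝ) 1, 0 < ρ δ) →
      HasPointwiseScalingLimit G ρ S → IsNondegenerateTwoPoint S → IsMoebiusCovariant (1/2) S →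
      ¬ HasNontrivialU4 S → ¬ Tendsto (fun m : ℕ => ρ (1 / m) ^ 2 / m) atTop atTop := by
  intro h
  refine h screenedLattice renorm (gffFamily (1/2)) (fun δ hδ => renorm_pos hδ.1 hδ.2)
    screenedLattice_hasLimit (isNondegenerateTwoPoint_gff _) (isMoebiusCovariant_gff _)
    (not_hasNontrivialU4_gff _) ?_
  have h1 : Tendsto (fun m : ℕ => 1 + Real.log m) atTop atTop :=
    tendsto_atTop_add_const_left _ 1 (Real.tendsto_log_atTop.comp tendsto_natCast_atTop_atTop)
  refine h1.congr' ?_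
  filter_upwards [eventually_ge_atTop 1] with m hm
  have hm0 : (0:ℝ) < m := by exact_mod_cast hm
  have hm1 : (1:ℝ) / m ≤ 1 := by rw [div_le_one hm0]; exact_mod_cast hm
  rw [renorm_sq (by positivity) hm1, Real.log_div one_ne_zero hm0.ne', Real.log_one]
  field_simp
  ring


/-! ## (a3) All-orders version: the witness as an honest Gaussian moment family (hafnians)

To pre-empt the repair "require `S` (and the lattice family) to be the FULL free field at every
order": the hafnian (all-orders Wick) family `haf K` of a pair kernel `K` — `haf K 0 = 1`,
`haf K 1 = 0`, `haf K (n+2) x = Σⱼ K(x₀, x_{j+1}) · haf K n (x minus {0, j+1})` — is Möbius covariant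
with dimension `Δ` whenever `K` is a covariant two-point kernel, has `U₄ ≡ 0`, and the hafnian
family of the screened kernel `gL` converges AT EVERY ORDER to the hafnian family of `‖a-b‖⁻¹`, i.e.
to the massless free field with all its correlators. -/

section Hafnian

variable {α : Type*}

/-- Removal of the indices `0` and `j.succ` from `Fin (n+2)`, as an order-preserving map
`Fin n → Fin (n+2)`. [folklore] -/
def rem {n : ℕ} (j : Fin (n + 1)) (i : Fin n) : Fin (n + 2) := (j.succAbove i).succ

/-- `rem j` is injective. [folklore] -/
theorem rem_injective {n : ℕ} (j : Fin (n + 1)) : Function.Injective (rem j) :=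
  fun _ _ h => Fin.succAbove_right_injective (Fin.succ_injective _ h)

/-- `rem j` avoids `0`. [folklore] -/
theorem rem_ne_zero {n : ℕ} (j : Fin (n + 1)) (i : Fin n) : rem j i ≠ 0 := Fin.succ_ne_zero _

/-- `rem j` avoids `j.succ`. [folklore] -/
theorem rem_ne_succ {n : ℕ} (j : Fin (n + 1)) (i : Fin n) : rem j i ≠ j.succ := by
  intro h
  exact Fin.succAbove_ne j i (Fin.succ_injective _ h)

/-- The hafnian (all-orders Wick / free-field moment) family of a pair kernel. [folklore] -/
def haf (K : α → α → ℝ) : (n : ℕ) → (Fin n → α) → ℝ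
  | 0, _ => 1
  | 1, _ => 0
  | n + 2, x => ∑ j : Fin (n + 1), K (x 0) (x j.succ) * haf K n (fun i => x (rem j i))

/-- `haf K 0 = 1`. [folklore] -/
@[simp] theorem haf_zero (K : α → α → ℝ) (x : Fin 0 → α) : haf K 0 x = 1 := rfl
/-- `haf K 1 = 0`. [folklore] -/
@[simp] theorem haf_one (K : α → α → ℝ) (x : Fin 1 → α) : haf K 1 x = 0 := rfl
/-- The recursion (expansion along the first point). [folklore] -/
theorem haf_succ_succ (K : α → α → ℝ) (n : ℕ) (x : Fin (n + 2) → α) :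
    haf K (n + 2) x = ∑ j : Fin (n + 1), K (x 0) (x j.succ) * haf K n (fun i => x (rem j i)) := rfl

/-- `haf K 2 (a, b) = K a b`. [folklore] -/
theorem haf_two (K : α → α → ℝ) (x : Fin 2 → α) : haf K 2 x = K (x 0) (x 1) := by
  simp [haf_succ_succ]

/-- The hafnian is invariant under maps preserving the kernel. [folklore] -/
theorem haf_map {β : Type*} (K : α → α → ℝ) (K' : β → β → ℝ) (φ : α → β)
    (hK : ∀ a b, K' (φ a) (φ b) = K a b) : ∀ (n : ℕ) (x : Fin n → α), haf K' n (φ ∘ x) = haf K n x := by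
  intro n
  induction n using Nat.twoStepInduction with
  | zero => intro x; rfl
  | one => intro x; rfl
  | more n ih _ =>
    intro x
    rw [haf_succ_succ, haf_succ_succ]
    refine Finset.sum_congr rfl fun j _ => ?_
    rw [Function.comp_apply, Function.comp_apply, hK]
    congr 1
    exact ih (fun i => x (rem j i))

/-- Homogeneity: scaling the kernel by `c` scales `haf K n` like `ρⁿ` with `ρ² = c`; precisely
`ρ ^ n * haf K n x = haf (ρ² K) n x`. [folklore] -/
theorem pow_mul_haf (K : α → α → ℝ) (ρ : ℝ) :
    ∀ (n : ℕ) (x : Fin n → α), ρ ^ n * haf K n x = haf (fun a b => ρ ^ 2 * K a b) n x := by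
  intro n
  induction n using Nat.twoStepInduction with
  | zero => intro x; simp
  | one => intro x; simp
  | more n ih _ =>
    intro x
    rw [haf_succ_succ, haf_succ_succ, Finset.mul_sum]
    refine Finset.sum_congr rfl fun j _ => ?_
    rw [← ih]
    ring

/-- Scale covariance of the hafnian family of a kernel of dimension `Δ` on `ℝ³`. [folklore] -/
theorem haf_smul (K : EuclideanSpace ℝ (Fin 3) → EuclideanSpace ℝ (Fin 3) → ℝ) (Δ : ℝ) {c : ℝ} (hc : 0 < c)
    (hK : ∀ a b, K (c • a) (c • b) = c ^ (-(2 * Δ)) * K a b) :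
    ∀ (n : ℕ) (x : Fin n → EuclideanSpace ℝ (Fin 3)),
      haf K n (fun i => c • x i) = c ^ (-(n : ℝ) * Δ) * haf K n x := by
  intro n
  induction n using Nat.twoStepInduction with
  | zero => intro x; simp
  | one => intro x; simp
  | more n ih _ =>
    intro x
    rw [haf_succ_succ, haf_succ_succ, Finset.mul_sum]
    refine Finset.sum_congr rfl fun j _ => ?_
    have h2 := ih (fun i => x (rem j i))
    rw [hK, h2]
    have hexp : c ^ (-((n + 2 : ℕ) : ℝ) * Δ) = c ^ (-(2 * Δ)) * c ^ (-(n : ℝ) * Δ) := by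
      rw [← Real.rpow_add hc]; congr 1; push_cast; ring
    rw [hexp]; ring

/-- Inversion covariance of the hafnian family of an inversion-covariant kernel. [folklore] -/
theorem haf_inversion (K : EuclideanSpace ℝ (Fin 3) → EuclideanSpace ℝ (Fin 3) → ℝ) (Δ : ℝ)
    (hK : ∀ a b, a ≠ 0 → b ≠ 0 →
      K (EuclideanGeometry.inversion 0 1 a) (EuclideanGeometry.inversion 0 1 b) =
        ‖a‖ ^ (2 * Δ) * ‖b‖ ^ (2 * Δ) * K a b) :
    ∀ (n : ℕ) (x : Fin n → EuclideanSpace ℝ (Fin 3)), (∀ i, x i ≠ 0) →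
      haf K n (fun i => EuclideanGeometry.inversion 0 1 (x i)) = (∏ i, ‖x i‖ ^ (2 * Δ)) * haf K n x := by
  intro n
  induction n using Nat.twoStepInduction with
  | zero => intro x _; simp
  | one => intro x _; simp
  | more n ih _ =>
    intro x hx
    rw [haf_succ_succ, haf_succ_succ, Finset.mul_sum]
    refine Finset.sum_congr rfl fun j _ => ?_
    have h2 := ih (fun i => x (rem j i)) (fun i => hx _)
    rw [hK _ _ (hx _) (hx _), h2, Fin.prod_univ_succ, Fin.prod_univ_succAbove _ j]
    simp only [rem]
    ring

/-- The connected four-point function of a hafnian family vanishes identically (the order-4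
recursion IS the Wick sum, in the order used by `limitConnectedFour`). [folklore] -/
theorem limitConnectedFour_haf (K : EuclideanSpace ℝ (Fin 3) → EuclideanSpace ℝ (Fin 3) → ℝ)
    (x : Fin 4 → EuclideanSpace ℝ (Fin 3)) :
    limitConnectedFour (haf K) x = 0 := by
  simp [limitConnectedFour, haf_succ_succ, Fin.sum_univ_succ, rem, Fin.succAbove]
  ring

/-- Finite sums of locally uniformly convergent real functions converge locally uniformly. [folklore] -/
theorem tendstoLocallyUniformlyOn_finset_sum {ι X κ : Type*} [TopologicalSpace X]
    {p : Filter ι} {s : Set X} (t : Finset κ) (F : κ → ι → X → ℝ) (f : κ → X → ℝ)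
    (h : ∀ k ∈ t, TendstoLocallyUniformlyOn (F k) (f k) p s) :
    TendstoLocallyUniformlyOn (fun i x => ∑ k ∈ t, F k i x) (fun x => ∑ k ∈ t, f k x) p s := by
  classical
  induction t using Finset.induction_on with
  | empty =>
    simp only [Finset.sum_empty]
    exact ((tendsto_const_nhds (x := (0:ℝ))).tendstoUniformlyOn_const s).tendstoLocallyUniformlyOn
  | insert a t ha ih =>
    simp only [Finset.sum_insert ha]
    exact (h a (Finset.mem_insert_self a t)).add (ih fun k hk => h k (Finset.mem_insert_of_mem hk))

/-- Removing two points maps non-coincident configurations to non-coincident ones. [folklore] -/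
theorem mapsTo_rem {n : ℕ} (j : Fin (n + 1)) :
    Set.MapsTo (fun x : Fin (n + 2) → EuclideanSpace ℝ (Fin 3) => fun i => x (rem j i))
      (NonCoincident 3 (n + 2)) (NonCoincident 3 n) :=
  fun x hx => (mem_nonCoincident _).2 (((mem_nonCoincident x).1 hx).comp (rem_injective j))

/-- The free-field hafnian family `haf (‖·-·‖⁻¹) n` is continuous on non-coincident configurations. [folklore] -/
theorem continuousOn_haf_inv : ∀ n : ℕ, ContinuousOn
    (haf (fun a b : EuclideanSpace ℝ (Fin 3) => ‖a - b‖⁻¹) n) (NonCoincident 3 n) := by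
  intro n
  induction n using Nat.twoStepInduction with
  | zero => exact continuousOn_const
  | one => exact continuousOn_const
  | more n ih _ =>
    simp only [funext (haf_succ_succ _ n)]
    refine continuousOn_finsetSum _ fun j _ => ?_
    refine (continuousOn_inv_dist (0 : Fin (n+2)) j.succ (Fin.succ_ne_zero j).symm).mul ?_
    exact ih.comp (by fun_prop) (mapsTo_rem j)

/-- **All orders**: the rescaled hafnian family of the level-`(1 - log δ)` comparison kernel at the
rounded configuration converges to the free-field hafnian family, locally uniformly on non-coincident
configurations, for EVERY `n`. [folklore] -/
theorem tendsto_haf : ∀ n : ℕ, TendstoLocallyUniformlyOn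
    (fun δ x => haf (fun a b : EuclideanSpace ℝ (Fin 3) => psi (1 - Real.log δ) ‖a - b‖) n (roundCfg δ x))
    (haf (fun a b : EuclideanSpace ℝ (Fin 3) => ‖a - b‖⁻¹) n) (𝓝[>] 0) (NonCoincident 3 n) := by
  intro n
  induction n using Nat.twoStepInduction with
  | zero =>
    exact (((tendsto_const_nhds (x := (1:ℝ))).tendstoUniformlyOn_const _).tendstoLocallyUniformlyOn).congr
      (fun δ x _ => by simp) |>.congr_right fun x _ => by simp
  | one =>
    exact (((tendsto_const_nhds (x := (0:ℝ))).tendstoUniformlyOn_const _).tendstoLocallyUniformlyOn).congr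
      (fun δ x _ => by simp) |>.congr_right fun x _ => by simp
  | more n ih _ =>
    have hsum := tendstoLocallyUniformlyOn_finset_sum (Finset.univ : Finset (Fin (n + 1)))
      (fun j δ x => psi (1 - Real.log δ) ‖roundCfg δ x 0 - roundCfg δ x j.succ‖ *
        haf (fun a b : EuclideanSpace ℝ (Fin 3) => psi (1 - Real.log δ) ‖a - b‖) n
          (roundCfg δ (fun i => x (rem j i))))
      (fun j x => ‖x 0 - x j.succ‖⁻¹ *
        haf (fun a b : EuclideanSpace ℝ (Fin 3) => ‖a - b‖⁻¹) n (fun i => x (rem j i)))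
      (fun j _ => (tendsto_pair (0 : Fin (n+2)) j.succ (Fin.succ_ne_zero j).symm).mul₀
        (ih.comp _ (mapsTo_rem j) (by fun_prop))
        (continuousOn_inv_dist (0 : Fin (n+2)) j.succ (Fin.succ_ne_zero j).symm)
        ((continuousOn_haf_inv n).comp (by fun_prop) (mapsTo_rem j)))
    refine (hsum.congr fun δ x _ => ?_).congr_right fun x _ => ?_
    · simp only [haf_succ_succ]; rfl
    · simp only [haf_succ_succ]

/-- THE ALL-ORDERS LATTICE WITNESS: the free (hafnian) moment family of the screened kernel `gL`. [folklore] -/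
def screenedLatticeAll : LatticeCorrFamily 3 := haf gL

/-- THE ALL-ORDERS LIMIT: the massless free field on `ℝ³` with all its correlators. [folklore] -/
def freeField : CorrFamily 3 := haf fun a b : EuclideanSpace ℝ (Fin 3) => ‖a - b‖⁻¹

/-- The free field is non-degenerate. [folklore] -/
theorem freeField_isNondegenerateTwoPoint : IsNondegenerateTwoPoint freeField := by
  intro x hx
  rw [freeField, haf_two]
  exact inv_pos.2 (norm_pos_iff.2 (sub_ne_zero.2 (((mem_nonCoincident x).1 hx).ne (by decide))))

/-- The free field has `U₄ ≡ 0`. [folklore] -/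
theorem freeField_not_hasNontrivialU4 : ¬ HasNontrivialU4 freeField := by
  rintro ⟨x, -, hne⟩
  exact hne (limitConnectedFour_haf _ x)

/-- The free field is Möbius covariant with `Δ = 1/2` at every order. [folklore] -/
theorem freeField_isMoebiusCovariant : IsMoebiusCovariant (1/2) freeField := by
  refine ⟨⟨fun n v x => ?_, fun n R x => ?_⟩, fun n c hc x => ?_, fun n x hx => ?_⟩
  · exact haf_map (fun a b : EuclideanSpace ℝ (Fin 3) => ‖a - b‖⁻¹) _ (fun a => a + v)
      (fun a b => by simp) n x
  · exact haf_map (fun a b : EuclideanSpace ℝ (Fin 3) => ‖a - b‖⁻¹) _ R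
      (fun a b => by simp only [← map_sub, LinearIsometryEquiv.norm_map]) n x
  · refine haf_smul _ (1/2) hc (fun a b => ?_) n x
    rw [← smul_sub, norm_smul, Real.norm_eq_abs, abs_of_pos hc, mul_inv,
      show (-(2 * (1/2:ℝ))) = -1 by norm_num, Real.rpow_neg_one]
  · refine haf_inversion _ (1/2) (fun a b ha hb => ?_) n x hx
    have h := gffTwo_inversion (1/2) ha hb
    simpa only [gffTwo_half] using h

/-- The rescaled all-orders witness at mesh `δ ∈ (0,1]` is the comparison hafnian family at the
rounded configuration. [folklore] -/
theorem rescaledCorrelator_screenedLatticeAll {δ : ℝ} (hδ : 0 < δ) (hδ1 : δ ≤ 1) (n : ℕ)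
    (x : Fin n → EuclideanSpace ℝ (Fin 3)) :
    rescaledCorrelator screenedLatticeAll renorm n δ x =
      haf (fun a b : EuclideanSpace ℝ (Fin 3) => psi (1 - Real.log δ) ‖a - b‖) n (roundCfg δ x) := by
  rw [rescaledCorrelator_apply, screenedLatticeAll, pow_mul_haf]
  have hpair : ∀ a b : Site 3, renorm δ ^ 2 * gL a b = psi (1 - Real.log δ) ‖δ • ι a - δ • ι b‖ := by
    intro a b
    rw [gL, renorm_sq_mul_phi hδ hδ1, ← smul_sub, norm_smul, Real.norm_eq_abs, abs_of_pos hδ]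
  exact (haf_map (fun a b : Site 3 => renorm δ ^ 2 * gL a b) _ (fun k => δ • ι k)
    (fun a b => (hpair a b).symm) n _).symm

/-- **All orders: the screened free lattice family has the massless free field as pointwise scaling
limit at every order.** [folklore] -/
theorem screenedLatticeAll_hasLimit : HasPointwiseScalingLimit screenedLatticeAll renorm freeField := by
  intro n
  refine tendstoLocallyUniformlyOn_congr_eventually (tendsto_haf n) ?_
  filter_upwards [Ioc_mem_nhdsGT (zero_lt_one' ℝ)] with δ hδ x _
  exact (rescaledCorrelator_screenedLatticeAll hδ.1 hδ.2 n x).symm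

/-- The all-orders witness has the same two-point function. [folklore] -/
theorem screenedLatticeAll_two (x : Site 3) : screenedLatticeAll 2 ![0, x] = screenedLattice 2 ![0, x] := by
  rw [screenedLatticeAll, haf_two, screenedLattice_two]
  simp [gL, norm_neg]

/-- **`¬ CruxWithoutIsing`, all-orders witness**: the model-blind crux fails for an honest free
(Gaussian at every order) lattice moment family whose limit is the full massless free field. [folklore] -/
theorem cruxWithoutIsing_false' : ¬ CruxWithoutIsing := by
  intro h
  refine h screenedLatticeAll renorm (1/2) freeField (fun δ hδ => renorm_pos hδ.1 hδ.2)
    screenedLatticeAll_hasLimit freeField_isNondegenerateTwoPoint freeField_isMoebiusCovariant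
    freeField_not_hasNontrivialU4 ?_
  simpa only [screenedLatticeAll_two] using screenedLattice_screened

end Hafnian

end Summit.CriticalPhenomena.Ising3DConformalLimit.Cruxes.GaussianLimitNotScreened.Disproof

end
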